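import Mathlib
import HarnessLib
import Literature.MathematicalPhysics.QuantumLattice.FermiRG.BGM2003Sectors
import Literature.MathematicalPhysics.QuantumLattice.SectorSymbolMasterZero
import Summits.HubbardSuperconductivity.HubbardSuperconductivity.Theorems.KLProgrammeH10TwoPointLimitPerturbedFermiRadiusJoint
import Summits.HubbardSuperconductivity.HubbardSuperconductivity.Theorems.KLProgrammeH10TwoPointLimitPerturbedFermiRadiusCurvature
import Summits.HubbardSuperconductivity.HubbardSuperconductivity.Theorems.KLProgrammeH10TwoPointLimitFramePerturbation
import Summits.HubbardSuperconductivity.HubbardSuperconductivity.Theorems.KLProgrammeFermiSurfaceEnvelope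

/-!
# Route `KLProgramme` — K1/K3 (stmt-HubbardSuperconductivity-19938 / 20437), risk-register item 2:
# BGM 2003's DISPERSION HYPOTHESES §1.2 (2.8a)–(2.8c) HOLD ON THE CURVE OF EVERY SMALL `C²` PERTURBATION OF THE BAND — in particular on every frame

Cell gate-hubbard-kl, seat p4 (C5a), g11.  `FermiRG.BGM2003.DispersionHyp ε μ e₀ u` (typer file `Literature/…/FermiRG/BGM2003Sectors.lean`) is the
predicate under which the tree PROVES Benfatto–Giuliani–Mastropietro 2003's sector lemmata 7.1–7.5 and the SECTOR COUNTING LEMMA 3.1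
(`BGM2003.lemma31_sectorCounting_holds`: the `(L−3)` relative count with momentum conservation in `ℝ²`) for a general smooth convex centrally
symmetric dispersion.  fs-1 instantiated it for the FREE band (`klfs_bgm2003_dispersionHyp`).  This file instantiates it for the PERTURBED dispersions
`ε = ε₀ + δ` of the lineage — `δ ∈ C^∞` even, `|δ| ≤ κ₀`, `‖Dδ‖ ≤ κ₁`, `‖D²δ‖ ≤ κ₂` on the closed square, small against the window's band constants —
with the polar chart `u θ e := perturbedFermiRadius δ (μ + e) θ`:

* **`dispersionHyp_perturbed`** — the eleven fields: `smooth_u` = `contDiffOn_perturbedFermiRadius_shell` (joint implicit function),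
  `convex` = `polarCurvature_perturbed_ge` (the curvature identity), `radial` = `Dt_min − κ₁ ≤ ∇ε·e⃗_r ≤ 4 + κ₁`, `level`/`u_pos`/`antipodal`/`periodic`
  from `…PerturbedFermiCurveDefs`, `symm` from evenness;
* **`dispersionHyp_frame`** — for every level window `[μ₁, μ₂] ⊂ (-4, 0)` there are `e₀, κ > 0` such that EVERY frame `K : TrigPolyC4v` of `C²` size `A`
  with `4A ≤ κ` satisfies `DispersionHyp (ε₀ + δ_K) μ e₀ u_K` at every `μ ∈ [μ₁, μ₂]`;
* **`dispersionHyp_frameOK`** — the same ON EVERY ADMISSIBLE FRAME IN THE KL REGIME (`FrameOK R U (nScales β) ν K`, `0 < c ≤ c₃(R)`, `0 < U ≤ U₀(R)`,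
  `klBetaMin ≤ β ≤ e^{c/U²}`).

Consequences by composition with t3's proofs (BGM 2003 Lemmas 7.1–7.5, 3.1 on every admissible frame) are the companion file
`…FrameBGM2003SectorCounting`.  Everything is PROVED; no definitions, no named facts.  References: BGM 2003 §1.2 (2.8a)–(2.8c), §3.1 Lemma 3.1
[cite: BenfattoGiulianiMastropietro2003]; BGM 2006 §2.4 Lemma 2.1 [cite: BenfattoGiulianiMastropietro2006].
-/

noncomputable section

namespace Summit.HubbardSuperconductivity.HubbardSuperconductivity.Theorems.PerturbedFermiCurve

set_option linter.dupNamespace false -- summit = problem name (single-conjunct summit), D-0017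

open Real Set
open Literature.MathematicalPhysics.QuantumLattice Literature.MathematicalPhysics.QuantumLattice.BandSectorCounting
open Literature.MathematicalPhysics.QuantumLattice.FermiRG
open Summit.HubbardSuperconductivity.HubbardSuperconductivity.Theorems.DispersionFlow
open Summit.HubbardSuperconductivity.HubbardSuperconductivity.Theorems.KLRegimeSplit

/-! ## §1 The radial derivative of `ε₀ + δ` at a ray point -/

/-- `∇ε₀(t·e⃗_r(θ))·e⃗_r(θ) = ∂_tF(θ, t)`. [folklore] -/
theorem fderiv_sqDispersion_smul_dir (θ t : ℝ) : fderiv ℝ sqDispersion (t • dir θ) (dir θ) = rayDispersionDt θ t := by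
  rw [fderiv_sqDispersion_apply, rayDispersionDt]
  simp [dir, smul_eq_mul]
  ring

/-- `∇(ε₀ + δ)(t·e⃗_r(θ))·e⃗_r(θ) = ∂_tF(θ,t) + Dδ(t·e⃗_r)[e⃗_r]` for differentiable `δ`. [folklore] -/
theorem fderiv_pert_smul_dir {δ : (Fin 2 → ℝ) → ℝ} {θ t : ℝ} (hd : DifferentiableAt ℝ δ (t • dir θ)) :
    fderiv ℝ (fun k => sqDispersion k + δ k) (t • dir θ) (dir θ) = rayDispersionDt θ t + fderiv ℝ δ (t • dir θ) (dir θ) := by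
  have h0 : DifferentiableAt ℝ sqDispersion (t • dir θ) := (contDiff_sqDispersion.differentiable one_ne_zero).differentiableAt
  show fderiv ℝ (sqDispersion + δ) (t • dir θ) (dir θ) = _
  rw [fderiv_add h0 hd, add_apply, fderiv_sqDispersion_smul_dir]

/-! ## §2 BGM 2003 §1.2 for a small smooth even perturbation of the band -/

/-- **BGM 2003's dispersion hypotheses for `ε₀ + δ`.**  Let `B : BandBounds a b`, `δ ∈ C^∞` even with `|δ| ≤ κ₀`, `‖Dδ‖ ≤ κ₁`, `‖D²δ‖ ≤ κ₂` on the
closed square, `2κ₁ ≤ Dt_min`, the convexity margin `h_min ≤ 2h_E − κ₂S_E²` (`h_E`, `S_E` of `hess_perturbed_ge` / `abs_VXE_le`), and a shell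
`0 < e₀` with `a + κ₀ + 2e₀ ≤ μ ≤ b − κ₀ − 2e₀`.  Then `DispersionHyp (ε₀ + δ) μ e₀ (fun θ e ↦ perturbedFermiRadius δ (μ + e) θ)` — with
`u ≥ u_min`, `1/r ≥ u_min h_min/((4 + κ₁)(2S_E)³)`, `Dt_min − κ₁ ≤ ∇ε·e⃗_r ≤ 4 + κ₁`. [cite: BenfattoGiulianiMastropietro2003, §1.2 (2.8a)-(2.8c)] -/
theorem dispersionHyp_perturbed {a b : ℝ} (B : BandBounds a b) {δ : (Fin 2 → ℝ) → ℝ}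
    (hδs : ContDiff ℝ ((⊤ : ℕ∞) : WithTop ℕ∞) δ) (heven : ∀ k, δ (-k) = δ k) {κ₀ κ₁ κ₂ : ℝ}
    (hδ : ∀ k : Fin 2 → ℝ, (∀ i, |k i| ≤ π) → |δ k| ≤ κ₀)
    (hκ : ∀ k : Fin 2 → ℝ, (∀ i, |k i| ≤ π) → ‖fderiv ℝ δ k‖ ≤ κ₁)
    (hκ₂ : ∀ k : Fin 2 → ℝ, (∀ i, |k i| ≤ π) → ‖fderiv ℝ (fderiv ℝ δ) k‖ ≤ κ₂)
    (hκ₁D : 2 * κ₁ ≤ B.Dtmin)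
    (hconv : B.hmin ≤ 2 * (B.hmin - 4 * (κ₁ * (π * Real.sqrt 2 + 2 * B.smax) / (B.Dtmin - κ₁)) *
        ((B.smax + κ₁ * (π * Real.sqrt 2 + 2 * B.smax) / (B.Dtmin - κ₁)) + B.smax)) -
        κ₂ * (B.smax + κ₁ * (π * Real.sqrt 2 + 2 * B.smax) / (B.Dtmin - κ₁)) ^ 2)
    {μ e₀ : ℝ} (he₀ : 0 < e₀) (hlo : a + κ₀ + 2 * e₀ ≤ μ) (hhi : μ + κ₀ + 2 * e₀ ≤ b) :
    BGM2003.DispersionHyp (fun k => sqDispersion k + δ k) μ e₀ (fun θ e => perturbedFermiRadius δ (μ + e) θ) := by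
  have hδc : Continuous δ := hδs.continuous
  have htop : ((⊤ : ℕ∞) : WithTop ℕ∞) ≠ 0 := by simp
  have hδ2 : ContDiff ℝ 2 δ := hδs.of_le (WithTop.coe_le_coe.mpr le_top)
  have hdiff : ∀ k, DifferentiableAt ℝ δ k := fun k => (hδs.differentiable htop) k
  have hκ₁0 : 0 ≤ κ₁ := le_trans (norm_nonneg _) (hκ 0 (by intro i; simp [Real.pi_pos.le]))
  have hκ₁ : κ₁ < B.Dtmin := by linarith [B.Dtmin_pos]
  -- every shell level is admissible
  have hlev : ∀ e : ℝ, |e| ≤ e₀ → a ≤ μ + e - κ₀ ∧ μ + e + κ₀ ≤ b := fun e he => by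
    have h := abs_le.1 he; exact ⟨by linarith [h.1], by linarith [h.2]⟩
  -- the root selection at level `μ + e`
  have hroot : ∀ e : ℝ, |e| ≤ e₀ → ∀ θ, IsBandFermiRadius (μ + e - δ (perturbedFermiRadius δ (μ + e) θ • dir θ)) θ
      (perturbedFermiRadius δ (μ + e) θ) := fun e he θ =>
    isBandFermiRadius_perturbedFermiRadius B hδc hδ (hlev e he).1 (hlev e he).2 θ
  set SE := B.smax + κ₁ * (π * Real.sqrt 2 + 2 * B.smax) / (B.Dtmin - κ₁) with hSE
  have hSEpos : 0 < SE := by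
    rw [hSE]; have := B.smax_pos; have : 0 < B.Dtmin - κ₁ := by linarith
    positivity
  refine
    { e₀_pos := he₀
      smooth_ε := contDiff_sqDispersion.add hδs
      smooth_u := ?_
      periodic_u := fun e θ => perturbedFermiRadius_add_two_pi δ (μ + e) θ
      u_pos := ⟨B.umin, B.umin_pos, fun θ e he => umin_le_perturbedFermiRadius B hδc hδ (hlev e he).1 (hlev e he).2 θ⟩
      level := fun θ e he => ?_
      convex := ?_
      radial := ?_
      symm := fun p => by simp only [klfs_sqDispersion_neg, heven]
      antipodal := fun θ e _ => perturbedFermiRadius_add_pi heven (μ + e) θ }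
  · -- joint smoothness on the shell `|e| < 2e₀`
    refine ⟨2 * e₀, by linarith, ?_⟩
    exact contDiffOn_perturbedFermiRadius_shell B hδs htop hδ hκ hκ₁ (by linarith) (by linarith)
  · -- the level property
    show sqDispersion (perturbedFermiRadius δ (μ + e) θ • dir θ) + δ (perturbedFermiRadius δ (μ + e) θ • dir θ) = μ + e
    exact sqDispersion_add_perturbedFermiRadius B hδc hδ (hlev e he).1 (hlev e he).2 θ
  · -- convexity
    refine ⟨B.umin * B.hmin / ((4 + κ₁) * (2 * SE) ^ 3), by have := B.umin_pos; have := B.hmin_pos; positivity, fun θ e he => ?_⟩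
    have hpos : 0 ≤ 2 * (B.hmin - 4 * (κ₁ * (π * Real.sqrt 2 + 2 * B.smax) / (B.Dtmin - κ₁)) * (SE + B.smax)) - κ₂ * SE ^ 2 :=
      le_trans B.hmin_pos.le hconv
    have h := polarCurvature_perturbed_ge B hδ2 hδ (hlev e he).1 (hlev e he).2 hκ hκ₁ hκ₂ (hroot e he) θ hpos
    have hmono : B.umin * B.hmin / ((4 + κ₁) * (2 * SE) ^ 3) ≤
        B.umin * (2 * (B.hmin - 4 * (κ₁ * (π * Real.sqrt 2 + 2 * B.smax) / (B.Dtmin - κ₁)) * (SE + B.smax)) - κ₂ * SE ^ 2) /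
          ((4 + κ₁) * (2 * SE) ^ 3) :=
      div_le_div_of_nonneg_right (mul_le_mul_of_nonneg_left hconv B.umin_pos.le) (by positivity)
    exact hmono.trans h
  · -- radial transversality
    have hD4 : B.Dtmin ≤ 4 := by
      have h0 : |(0 : ℝ)| ≤ e₀ := by rw [abs_zero]; exact he₀.le
      have h1 := Dtmin_le_rayDispersionDt_perturbedFermiRadius B hδc hδ (hlev 0 h0).1 (hlev 0 h0).2 0
      have h2 := (abs_le.1 (abs_rayDispersionDt_le_four 0 (perturbedFermiRadius δ (μ + 0) 0))).2
      linarith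
    refine ⟨B.Dtmin - κ₁, 4 + κ₁, by linarith, by linarith, fun θ e he => ?_⟩
    have hsq : ∀ i, |(perturbedFermiRadius δ (μ + e) θ • dir θ) i| ≤ π := abs_apply_le_pi_of_isBandFermiRadius (hroot e he θ)
    show B.Dtmin - κ₁ ≤ fderiv ℝ (fun k => sqDispersion k + δ k) (perturbedFermiRadius δ (μ + e) θ • dir θ) (dir θ) ∧
      fderiv ℝ (fun k => sqDispersion k + δ k) (perturbedFermiRadius δ (μ + e) θ • dir θ) (dir θ) ≤ 4 + κ₁
    rw [fderiv_pert_smul_dir (hdiff _)]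
    refine ⟨Dtmin_sub_le_pertDt B hδ (hlev e he).1 (hlev e he).2 hκ (hroot e he) θ, ?_⟩
    have h1 := (abs_le.1 (abs_rayDispersionDt_le_four θ (perturbedFermiRadius δ (μ + e) θ))).2
    have h2 := (abs_le.1 (abs_fderiv_dir_le (hκ _ hsq) θ)).2
    linarith

/-! ## §3 On the curve of every frame of small `C²` size, and in the KL regime -/

/-- **BGM 2003's dispersion hypotheses ON THE CURVE OF EVERY FRAME of small `C²` size**: for every level window `[μ₁, μ₂] ⊂ (-4, 0)` there are
a shell width `e₀ > 0` and `κ > 0` such that every frame `K : TrigPolyC4v` with `‖Dʲ(frameShift K)‖ ≤ A` (`j ≤ 2`), `4A ≤ κ`, satisfies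
`DispersionHyp (ε₀ + δ_K) μ e₀ (fun θ e ↦ perturbedFermiRadius δ_K (μ + e) θ)` at every `μ ∈ [μ₁, μ₂]` (`δ_K = frameShift K ∘ toLp`).
[cite: BenfattoGiulianiMastropietro2003, §1.2 (2.8a)-(2.8c)] -/
theorem dispersionHyp_frame :
    ∀ μ₁ μ₂ : ℝ, -4 < μ₁ → μ₁ ≤ μ₂ → μ₂ < 0 → ∃ e₀ : ℝ, 0 < e₀ ∧ ∃ κ : ℝ, 0 < κ ∧
      ∀ (K : TrigPolyC4v) (A : ℝ), (∀ p : Momentum, ∀ j ≤ 2, ‖iteratedFDeriv ℝ j (frameShift K) p‖ ≤ A) → 4 * A ≤ κ →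
      ∀ μ ∈ Set.Icc μ₁ μ₂, BGM2003.DispersionHyp (fun k => sqDispersion k + frameShift K (WithLp.toLp 2 k)) μ e₀
        (fun θ e => perturbedFermiRadius (fun k : Fin 2 → ℝ => frameShift K (WithLp.toLp 2 k)) (μ + e) θ) := by
  intro μ₁ μ₂ hμ₁ h12 hμ₂
  have ha : -4 < (μ₁ - 4) / 2 := by linarith
  have hab : (μ₁ - 4) / 2 ≤ μ₂ / 2 := by linarith
  have hb : μ₂ / 2 < 0 := by linarith
  obtain ⟨B, -⟩ : ∃ B : BandBounds ((μ₁ - 4) / 2) (μ₂ / 2), B = bandBounds ha hab hb := ⟨_, rfl⟩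
  obtain ⟨m₀, hm₀def⟩ : ∃ m₀ : ℝ, m₀ = min (μ₁ - (μ₁ - 4) / 2) (μ₂ / 2 - μ₂) := ⟨_, rfl⟩
  have hm₀ : 0 < m₀ := by rw [hm₀def]; exact lt_min (by linarith) (by linarith)
  have hm1 : m₀ ≤ μ₁ - (μ₁ - 4) / 2 := by rw [hm₀def]; exact min_le_left _ _
  have hm2 : m₀ ≤ μ₂ / 2 - μ₂ := by rw [hm₀def]; exact min_le_right _ _
  have hDt := B.Dtmin_pos; have hs := B.smax_pos; have hh := B.hmin_pos; have hπ := Real.pi_pos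
  -- the uniform majorants of `K_V`, `S_E`
  obtain ⟨c₁, hc₁⟩ : ∃ c₁ : ℝ, c₁ = π * Real.sqrt 2 + 2 * B.smax := ⟨_, rfl⟩
  have hc₁0 : 0 < c₁ := by rw [hc₁]; positivity
  obtain ⟨cV, hcV⟩ : ∃ cV : ℝ, cV = 2 * c₁ / B.Dtmin := ⟨_, rfl⟩
  have hcV0 : 0 < cV := by rw [hcV]; positivity
  obtain ⟨SEm, hSEm⟩ : ∃ SEm : ℝ, SEm = B.smax + c₁ := ⟨_, rfl⟩
  have hSEm0 : 0 < SEm := by rw [hSEm]; positivity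
  obtain ⟨κ, hκdef⟩ : ∃ κ : ℝ, κ = min B.Dtmin (min m₀ (B.hmin / (4 * cV * (SEm + B.smax) + SEm ^ 2))) := ⟨_, rfl⟩
  have hκ0 : 0 < κ := by rw [hκdef]; exact lt_min hDt (lt_min hm₀ (by positivity))
  have hκD : κ ≤ B.Dtmin := by rw [hκdef]; exact min_le_left _ _
  have hκm : κ ≤ m₀ := by rw [hκdef]; exact (min_le_right _ _).trans (min_le_left _ _)
  have hκh : κ ≤ B.hmin / (4 * cV * (SEm + B.smax) + SEm ^ 2) := by rw [hκdef]; exact (min_le_right _ _).trans (min_le_right _ _)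
  refine ⟨m₀ / 4, by positivity, κ, hκ0, ?_⟩
  intro K A hA hAκ μ hμ
  have hA0 : 0 ≤ A := le_trans (norm_nonneg _) (hA 0 0 (by norm_num))
  -- the perturbation `δ_K` and its sizes
  have hδ : ∀ k : Fin 2 → ℝ, (∀ i, |k i| ≤ π) → |frameShift K (WithLp.toLp 2 k)| ≤ A := fun k _ => abs_frameShift_toLp_le hA k
  have hκ₁ : ∀ k : Fin 2 → ℝ, (∀ i, |k i| ≤ π) → ‖fderiv ℝ (fun k : Fin 2 → ℝ => frameShift K (WithLp.toLp 2 k)) k‖ ≤ 2 * A :=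
    fun k _ => norm_fderiv_frameShift_toLp_le hA k
  have hκ₂ : ∀ k : Fin 2 → ℝ, (∀ i, |k i| ≤ π) →
      ‖fderiv ℝ (fderiv ℝ (fun k : Fin 2 → ℝ => frameShift K (WithLp.toLp 2 k))) k‖ ≤ 4 * A :=
    fun k _ => norm_fderiv_fderiv_frameShift_toLp_le hA k
  have h2κ₁ : 2 * (2 * A) ≤ B.Dtmin := by linarith
  -- the convexity margin
  have hden : B.Dtmin / 2 ≤ B.Dtmin - 2 * A := by linarith
  have hden0 : 0 < B.Dtmin - 2 * A := by linarith
  have hKV : 2 * A * (π * Real.sqrt 2 + 2 * B.smax) / (B.Dtmin - 2 * A) ≤ cV * (2 * A) := by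
    rw [← hc₁, hcV, div_le_iff₀ hden0]
    have e : 2 * c₁ / B.Dtmin * (2 * A) * (B.Dtmin - 2 * A) = 2 * A * c₁ * (2 * (B.Dtmin - 2 * A) / B.Dtmin) := by
      field_simp
    rw [e]
    have h1 : 1 ≤ 2 * (B.Dtmin - 2 * A) / B.Dtmin := by rw [le_div_iff₀ hDt]; linarith
    have h0 : 0 ≤ 2 * A * c₁ := by positivity
    nlinarith
  have hKV' : 2 * A * (π * Real.sqrt 2 + 2 * B.smax) / (B.Dtmin - 2 * A) ≤ c₁ := by
    refine hKV.trans ?_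
    rw [hcV]
    have : 2 * c₁ / B.Dtmin * (2 * A) = c₁ * (4 * A / B.Dtmin) := by
      field_simp
      ring
    rw [this]
    have h1 : 4 * A / B.Dtmin ≤ 1 := by rw [div_le_one hDt]; linarith
    nlinarith
  have hKV0 : 0 ≤ 2 * A * (π * Real.sqrt 2 + 2 * B.smax) / (B.Dtmin - 2 * A) := by positivity
  have hSE : B.smax + 2 * A * (π * Real.sqrt 2 + 2 * B.smax) / (B.Dtmin - 2 * A) ≤ SEm := by rw [hSEm]; linarith
  have hSE0 : 0 ≤ B.smax + 2 * A * (π * Real.sqrt 2 + 2 * B.smax) / (B.Dtmin - 2 * A) := by positivity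
  have hconv : B.hmin ≤ 2 * (B.hmin - 4 * (2 * A * (π * Real.sqrt 2 + 2 * B.smax) / (B.Dtmin - 2 * A)) *
        ((B.smax + 2 * A * (π * Real.sqrt 2 + 2 * B.smax) / (B.Dtmin - 2 * A)) + B.smax)) -
        4 * A * (B.smax + 2 * A * (π * Real.sqrt 2 + 2 * B.smax) / (B.Dtmin - 2 * A)) ^ 2 := by
    -- `8·K_V·(S_E + s_max) + κ₂·S_E² ≤ κ·(4cV(SEm + s_max) + SEm²) ≤ h_min`
    have h1 : 4 * (2 * A * (π * Real.sqrt 2 + 2 * B.smax) / (B.Dtmin - 2 * A)) *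
        ((B.smax + 2 * A * (π * Real.sqrt 2 + 2 * B.smax) / (B.Dtmin - 2 * A)) + B.smax) ≤ 4 * (cV * (2 * A)) * (SEm + B.smax) :=
      mul_le_mul (mul_le_mul_of_nonneg_left hKV (by norm_num)) (by linarith) (by positivity) (by positivity)
    have h2 : 4 * A * (B.smax + 2 * A * (π * Real.sqrt 2 + 2 * B.smax) / (B.Dtmin - 2 * A)) ^ 2 ≤ 4 * A * SEm ^ 2 :=
      mul_le_mul_of_nonneg_left (pow_le_pow_left₀ hSE0 hSE 2) (by positivity)
    have h3 : κ * (4 * cV * (SEm + B.smax) + SEm ^ 2) ≤ B.hmin := by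
      rwa [le_div_iff₀ (by positivity)] at hκh
    have h4 : 4 * A ≤ κ := hAκ
    have h5 : 0 ≤ 4 * cV * (SEm + B.smax) + SEm ^ 2 := by positivity
    nlinarith [mul_le_mul_of_nonneg_right h4 h5]
  -- the window margins
  have hlo : (μ₁ - 4) / 2 + A + 2 * (m₀ / 4) ≤ μ := by linarith [hμ.1]
  have hhi : μ + A + 2 * (m₀ / 4) ≤ μ₂ / 2 := by linarith [hμ.2]
  exact dispersionHyp_perturbed B (contDiff_frameShift_toLp K) (frameShift_toLp_neg K) hδ hκ₁ hκ₂ h2κ₁ hconv (by positivity) hlo hhi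

/-- **BGM 2003's dispersion hypotheses ON THE CURVE OF EVERY ADMISSIBLE FRAME IN THE KL REGIME**: for the window there is `e₀ > 0` and, for
every renormalisation package `R` (`Gfr ≥ 0`), thresholds `c₃, U₀ > 0` such that for all `0 < c ≤ c₃`, `0 < U ≤ U₀`, `klBetaMin ≤ β ≤ e^{c/U²}`,
every `μ ∈ [μ₁, μ₂]` and every frame with `FrameOK R U (nScales β) ν K`: `DispersionHyp (ε₀ + δ_K) μ e₀ (fun θ e ↦ perturbedFermiRadius δ_K (μ + e) θ)`.
[cite: BenfattoGiulianiMastropietro2003, §1.2 (2.8a)-(2.8c)] -/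
theorem dispersionHyp_frameOK :
    ∀ μ₁ μ₂ : ℝ, -4 < μ₁ → μ₁ ≤ μ₂ → μ₂ < 0 → ∃ e₀ : ℝ, 0 < e₀ ∧ ∀ R : RenConsts, (∀ j, 0 ≤ R.Gfr j) →
      ∃ c₃ : ℝ, 0 < c₃ ∧ ∃ U₀ : ℝ, 0 < U₀ ∧
      ∀ c : ℝ, 0 < c → c ≤ c₃ → ∀ U : ℝ, 0 < U → U ≤ U₀ → ∀ β : ℝ, klBetaMin ≤ β → β ≤ Real.exp (c / U ^ 2) →
      ∀ μ ∈ Set.Icc μ₁ μ₂, ∀ (ν : ℝ) (K : TrigPolyC4v), FrameOK R U (nScales β) ν K →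
      BGM2003.DispersionHyp (fun k => sqDispersion k + frameShift K (WithLp.toLp 2 k)) μ e₀
        (fun θ e => perturbedFermiRadius (fun k : Fin 2 → ℝ => frameShift K (WithLp.toLp 2 k)) (μ + e) θ) := by
  intro μ₁ μ₂ hμ₁ h12 hμ₂
  obtain ⟨e₀, he₀, κ, hκ, h⟩ := dispersionHyp_frame μ₁ μ₂ hμ₁ h12 hμ₂
  refine ⟨e₀, he₀, fun R hR => ?_⟩
  obtain ⟨c₃, hc₃, U₀, hU₀, hthr⟩ := frame_thresholds hR hκ
  refine ⟨c₃, hc₃, U₀, hU₀, ?_⟩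
  intro c hc hcle U hU hUle β hβmin hβc μ hμ ν K hK
  exact h K _ (fun p j hj => norm_iteratedFDeriv_frameShift_le_of_frameOK_regime hR hc.le hβmin hβc hK p hj)
    (hthr c U hc.le hcle hU hUle) μ hμ

end Summit.HubbardSuperconductivity.HubbardSuperconductivity.Theorems.PerturbedFermiCurve

end
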